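import Summits.HodgeConjecture.HodgeConjecture.Theorems.AnchorTransportVariationalHodgeReductions
import Literature.AlgebraicGeometry.HodgeTheory.QbarFamilyLocalSystem
import Literature.AlgebraicGeometry.HodgeTheory.MotivatedClassesDeformationInputs
import Literature.AlgebraicGeometry.Deligne1982.PrincipleBAlgebraicAnchor
import Literature.AlgebraicGeometry.Motives.AbelianVarietyProofs

/-!
# Route AnchorTransport — `VariationalHodge` (stmt-HodgeConjecture-1076): fibrewise rationality is decided at one fibre

The crux `AnchorTransport.VariationalHodge` assumes, for the global class `A ∈ H²ᵖ(𝒳(ℂ); ℂ)` of a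
smooth projective family `f : 𝒳 ⟶ S` over a smooth irreducible base, that EVERY fibre restriction
`A|_{𝒳_s}` is a rational class (and of Hodge type `(p,p)`). This file proves, unconditionally, that the
rationality half of this hypothesis is decided at a single fibre:

* `isRationalClass_fibre_of_isRationalClass_fibre_at` — for a smooth projective family over a smooth
  irreducible `ℂ`-scheme `S` and ANY class `A ∈ Hᵏ(𝒳(ℂ); ℂ)`, if `A|_{𝒳_{s₀}}` is rational for ONE
  complex point `s₀` then `A|_{𝒳_s}` is rational for EVERY `s`. Over an affine piece of the base (smooth,
  irreducible, hence of finite type and of pure dimension) `S(ℂ)` is a connected manifold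
  (`Deligne1982.preconnectedSpace_complexPoints_of_irreducibleSpace`,
  `pathConnectedSpace_complexPoints_of_smoothOfRelativeDimension`), `Rᵏ f_* ℂ` is a local system on it
  by Ehresmann (`isCohomologicallyLocallyTrivialOn_univ`), the restrictions of `A` form a flat section
  (`transportFun_map_fiberι`) and parallel transport preserves rational classes
  (`isRationalClass_transportFun_univ`); affine pieces are chained through the irreducible base
  (`forall_complexPoints_of_affineOpens`), the family being restricted to each (`Motives.familyPullback`).
* `variationalHodge_iff_rationalAtOnePoint` — hence the crux is EQUIVALENT to its form in which
  rationality of `A|_{𝒳_s}` is assumed at ONE point only (the Hodge-type condition stays fibrewise).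

Not claimed: dropping rationality altogether (an `A` with `A|_{𝒳_{s₀}}` in the `ℂ`-span of cycle classes
and all `A|_{𝒳_s}` of type `(p,p)`) is NOT an elementary reduction — it is the theorem of the fixed part
(item `DeligneGlobalInvariantCycles`), since `algebraicClasses` is a `ℂ`-subspace.

HONEST FRAMING: research route conditional on HC_CM; not a corollary; Q11.4-sentence-2 already refuted in
dim ≥ 3. Nothing here bears on `HC_CM`; no case of the Hodge conjecture and no instance of the crux is
proved — the file weakens one hypothesis of the crux's statement, both ways.
-/

noncomputable section

-- every declaration of this problem lives in `Summit.HodgeConjecture.HodgeConjecture.…` (summit = sub-problem)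
set_option linter.dupNamespace false

open CategoryTheory AlgebraicGeometry TopologicalSpace
open Literature.AlgebraicGeometry.Motives Literature.AlgebraicGeometry.HodgeTheory
open Summit.HodgeConjecture.HodgeConjecture.Theses.AnchorTransport

namespace Summit.HodgeConjecture.HodgeConjecture.Theorems

/-! ### Affine bases: transport along paths -/

/-- **Rationality of the fibre restrictions of a global class is constant over a smooth irreducible
AFFINE base** (any degree `k`, any class `A ∈ Hᵏ(𝒳(ℂ); ℂ)` of the total space of a smooth projective
family): join `s₀` to `s` by a path in the connected manifold `S(ℂ)`, along which `A|_{𝒳_{s₀}}` is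
transported to `A|_{𝒳_s}` (`transportFun_map_fiberι`) and stays rational
(`isRationalClass_transportFun_univ`). [cite: VoisinHodgeII2003, §3.1.2] -/
theorem isRationalClass_fibre_of_isRationalClass_fibre_at_of_isAffine {n k : ℕ} {𝒳 S : SchemeOver ℂ}
    (f : 𝒳 ⟶ S) (hf : IsSmoothProjectiveFamily f n) [IrreducibleSpace S.left] [IsAffine S.left]
    [AlgebraicGeometry.Smooth S.hom] (A : complexBetti 𝒳 k) {s₀ : ComplexPoints S}
    (h₀ : IsRationalClass (complexBetti.map (fiberι f s₀) k A)) (s : ComplexPoints S) :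
    IsRationalClass (complexBetti.map (fiberι f s) k A) := by
  -- the base: affine, smooth of pure dimension `d`, of finite type, separated, quasi-compact
  obtain ⟨d, hd⟩ := exists_smoothOfRelativeDimension_of_smooth S.hom
  haveI := hd
  haveI : LocallyOfFiniteType S.hom := inferInstance
  haveI : IsSeparated S.hom := inferInstance
  haveI : CompactSpace S.left := inferInstance
  haveI := hf.smoothOfRelativeDimension
  haveI := hf.isProper
  -- `S(ℂ)` is a connected manifold, hence path connected
  haveI : PreconnectedSpace (ComplexPoints S) :=
    Literature.AlgebraicGeometry.Deligne1982.preconnectedSpace_complexPoints_of_irreducibleSpace S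
  haveI : ConnectedSpace (ComplexPoints S) := ⟨⟨s₀⟩⟩
  haveI : PathConnectedSpace (ComplexPoints S) :=
    pathConnectedSpace_complexPoints_of_smoothOfRelativeDimension S d
  -- a path from `s₀` to `s`, read in the subtype `univ` over which the local system lives
  let ι : C(ComplexPoints S, (Set.univ : Set (ComplexPoints S))) :=
    ⟨fun x => ⟨x, Set.mem_univ x⟩, by fun_prop⟩
  let γ : Path (ι s₀) (ι s) := (PathConnectedSpace.somePath s₀ s).map ι.continuous
  have hU := isCohomologicallyLocallyTrivialOn_univ f n d
  have htr := transportFun_map_fiberι f k hU (⟦γ⟧ : Path.Homotopic.Quotient (ι s₀) (ι s)) A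
  change transportFun f k hU ⟦γ⟧ (complexBetti.map (fiberι f s₀) k A) =
    complexBetti.map (fiberι f s) k A at htr
  rw [← htr]
  exact isRationalClass_transportFun_univ f k n d ⟦γ⟧ h₀

/-! ### Smooth irreducible bases: chain of affine opens -/

/-- **Rationality of `A|_{𝒳_s}` is decided at one fibre** — for a smooth projective family
`f : 𝒳 ⟶ S` over a smooth IRREDUCIBLE `ℂ`-scheme and any `A ∈ Hᵏ(𝒳(ℂ); ℂ)`: if `A|_{𝒳_{s₀}}` is a
rational class for one complex point `s₀`, then `A|_{𝒳_s}` is rational for every `s`. Chain `s₀` to `s`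
through affine opens (`forall_complexPoints_of_affineOpens`); inside an affine open `U` restrict the
family to `U` (`Motives.familyPullback` along `U ↪ S`; the fibres are identified by
`fiberOverFamilyPullbackIso`, `map_fiberι_familyPullback`) and apply the affine case.
[cite: VoisinHodgeII2003, §3.1.2] -/
theorem isRationalClass_fibre_of_isRationalClass_fibre_at {n k : ℕ} {𝒳 S : SchemeOver ℂ}
    (f : 𝒳 ⟶ S) (hf : IsSmoothProjectiveFamily f n) [IrreducibleSpace S.left]
    [AlgebraicGeometry.Smooth S.hom] (A : complexBetti 𝒳 k) {s₀ : ComplexPoints S}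
    (h₀ : IsRationalClass (complexBetti.map (fiberι f s₀) k A)) (s : ComplexPoints S) :
    IsRationalClass (complexBetti.map (fiberι f s) k A) := by
  haveI : LocallyOfFiniteType S.hom := inferInstance
  refine forall_complexPoints_of_affineOpens
    (fun t => IsRationalClass (complexBetti.map (fiberι f t) k A)) (fun U hU a b haU hbU ha => ?_) h₀ s
  -- the affine open `U` as a smooth irreducible affine `ℂ`-scheme `g : U ⟶ S`
  haveI : IsOpenImmersion (openSubschemeOverι S U).left := inferInstanceAs (IsOpenImmersion U.ι)
  haveI hUaff : IsAffine (openSubschemeOver S U).left := hU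
  haveI hUirr : IrreducibleSpace (openSubschemeOver S U).left := by
    change IrreducibleSpace U
    exact isIrreducible_iff_irreducibleSpace.mp ⟨⟨a.pt, haU⟩,
      (PreirreducibleSpace.isPreirreducible_univ (X := S.left)).open_subset U.isOpen
        (Set.subset_univ _)⟩
  haveI hUsm : AlgebraicGeometry.Smooth (openSubschemeOver S U).hom := by
    change AlgebraicGeometry.Smooth (U.ι ≫ S.hom)
    infer_instance
  -- lift `a`, `b` to `U`
  have hrange : Set.range (AlgPoints.map (L := ℂ) (openSubschemeOverι S U)) = {P | P.pt ∈ U} := by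
    rw [AlgPoints.range_map_of_isOpenImmersion_holds]
    ext P
    change P.pt ∈ U.ι.opensRange ↔ P.pt ∈ U
    rw [Scheme.Opens.opensRange_ι]
  obtain ⟨a', rfl⟩ : a ∈ Set.range (AlgPoints.map (L := ℂ) (openSubschemeOverι S U)) := by
    rw [hrange]; exact haU
  obtain ⟨b', rfl⟩ : b ∈ Set.range (AlgPoints.map (L := ℂ) (openSubschemeOverι S U)) := by
    rw [hrange]; exact hbU
  -- move to the restricted family `𝒳 ×_S U ⟶ U`, apply the affine case, and come back
  set g := openSubschemeOverι S U
  have ha' : IsRationalClass (complexBetti.map (fiberι (familyPullback.snd f g) a') k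
      (complexBetti.map (familyPullback.fst f g) k A)) := by
    rw [map_fiberι_familyPullback]
    exact ha.map _
  have hb' := isRationalClass_fibre_of_isRationalClass_fibre_at_of_isAffine (familyPullback.snd f g)
    (hf.familyPullback_snd g) (complexBetti.map (familyPullback.fst f g) k A) ha' b'
  rw [map_fiberι_familyPullback] at hb'
  have hid : complexBetti.map (fiberOverFamilyPullbackIso f g b').symm.hom k
      (complexBetti.map (fiberOverFamilyPullbackIso f g b').hom k
        (complexBetti.map (fiberι f (AlgPoints.map g b')) k A)) =
      complexBetti.map (fiberι f (AlgPoints.map g b')) k A :=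
    map_hom_map_inv_apply (fiberOverFamilyPullbackIso f g b').symm k _
  rw [← hid]
  exact hb'.map _

/-! ### The crux with rationality assumed at one point only -/

/-- **The fibrewise rationality hypothesis of the crux is decided at one fibre**:
`AnchorTransport.VariationalHodge` is equivalent to the statement in which the global class `A` is
assumed of Hodge type `(p,p)` on every fibre but RATIONAL on ONE fibre only (any one; e.g. the anchor).
(`→`: rationality spreads to every fibre by `isRationalClass_fibre_of_isRationalClass_fibre_at`, then
the crux applies; `←`: specialise.) Dropping rationality altogether is NOT elementary (theorem of the
fixed part; `algebraicClasses` is a `ℂ`-span). -/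
theorem variationalHodge_iff_rationalAtOnePoint :
    VariationalHodge ↔
      ∀ ⦃n : ℕ⦄ ⦃𝒳 S : SchemeOver ℂ⦄ (f : 𝒳 ⟶ S), IsSmoothProjectiveFamily f n →
        IrreducibleSpace S.left → AlgebraicGeometry.Smooth S.hom →
        ∀ (p : ℕ) (A : complexBetti 𝒳 (2 * p)),
        (∀ s : ComplexPoints S,
          IsOfHodgeType n (fiberOver f s) (2 * p) p p (complexBetti.map (fiberι f s) (2 * p) A)) →
        (∃ s₁ : ComplexPoints S, IsRationalClass (complexBetti.map (fiberι f s₁) (2 * p) A)) →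
        (∃ s₀ : ComplexPoints S,
          complexBetti.map (fiberι f s₀) (2 * p) A ∈ algebraicClasses (fiberOver f s₀) p) →
        ∀ s : ComplexPoints S,
          complexBetti.map (fiberι f s) (2 * p) A ∈ algebraicClasses (fiberOver f s) p := by
  refine ⟨fun hV n 𝒳 S f hf hirr hsm p A hH hQ hs₀ s => ?_,
    fun h n 𝒳 S f hf hirr hsm p A hA hs₀ s =>
      h f hf hirr hsm p A (fun t => (hA t).2) ?_ hs₀ s⟩
  · obtain ⟨s₁, hs₁⟩ := hQ
    haveI := hirr
    haveI := hsm
    exact hV f hf hirr hsm p A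
      (fun t => ⟨isRationalClass_fibre_of_isRationalClass_fibre_at f hf A hs₁ t, hH t⟩) hs₀ s
  · obtain ⟨s₀, -⟩ := hs₀
    exact ⟨s₀, (hA s₀).1⟩

end Summit.HodgeConjecture.HodgeConjecture.Theorems

end
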